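import Summits.ResolutionOfSingularities.ResolutionOfSingularities.Theorems.FrobeniusClosingSteerThreadChainLemmas
import Summits.ResolutionOfSingularities.ResolutionOfSingularities.Theorems.FrobeniusClosingSteerGeoDictShorts
import Summits.ResolutionOfSingularities.ResolutionOfSingularities.Theorems.FrobeniusClosingSteerRadicandIsolatedOfMinimal
import Summits.ResolutionOfSingularities.ResolutionOfSingularities.Theorems.FrobeniusClosingSteerAutoPermissibleTwo
import Summits.ResolutionOfSingularities.ResolutionOfSingularities.Theorems.FrobeniusClosingSteerSteeredMembersRegular
import Summits.ResolutionOfSingularities.ResolutionOfSingularities.Theorems.FrobeniusClosingSteerSteeredExit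
import Mathlib.Algebra.CharP.Lemmas
import Mathlib.Algebra.CharP.Subring
import HarnessLib

/-!
# Thread chains, part 2: a finitely-hit thread is an eternal isolated radicand chain (Ĝ)

W4.1, crux `Steer` (stmt-ResolutionOfSingularities-16345), σ-line, §σ2.21 HIGH-WANDER FOREST (res-L0-w41-strat-2 delta rev 13
c7828a1d38db410e; res-L0-w41-plan-1 RULINGS 14d/15a: `ThreadWanderTwoN` → res-D-pv-011 AS res-L0-w41-stub-7; memo §6″ (F-b)(i)).
Theses-free, def-free. THE OBJECT (Θ1 of stub-7's SCOPING 2026-08-27T08:24Z): along an infinite thread of centres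
`P (j 0), P (j 1), …` (each the contraction of the next, all of height `c`) that is NOT HIT off the visits (no centre `P m` lies
below the thread prime `W m` for `m` strictly between visits), the germs `(R (j k))_{P (j k)} ⊆ K` with the radicands `(s m)^p`
form an eternal isolated `p`-radicand chain of dimension `c` — so the body of the W4.1 R2 sketch's
`NoEternalIsolatedRadicandChain p c` fails (`ThreadChain.not_noEternalChain_of_thread`). This is G10
(`GeoDict.not_noEternalChain_of_dominantTail`, p503815: the consecutive case `j k = i₀ + k`) with IDENTITY STEPS:
between visits the germ does not move (`ThreadChain.locChar_eq_of_le`, part 1) and the radicand is rescaled by units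
(`s (j k + 1) = X · s (j (k+1)) + G` with `X` a product of exceptional parameters avoiding the thread prime), which the chain
tolerates (`x k := X · x_{j (k+1)}`, `g k := X · g_{j (k+1)} + G`; multiplicity and isolatedness transported by
`ThreadChain.isRegularLocalRing_adjoinRoot_rescale`). Chain member `k` = the germ at visit `k+1` with radicand `s (j k + 1) ^ p`.
With K(c) (K(1) p500126; K(2) modulo Lipman p505893; K(3) modulo CP2019 p509311) a finitely-hit thread of height `c ≤ 3` is
therefore impossible; infinitely-hit threads produce lower-height positive steps (stub-7's Θ2/Θ3, in-skeleton by graded König).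
OURS (the W4.1 engine). [cite: Cutkosky2014, §2.1] [cite: NovacoskiSpivakovsky2014, Def. 2.11] [cite: Matsumura1987, Thm. 19.3]
-/

noncomputable section

-- `Summit.<S>.<S>.…` duplicates the summit name by design (single-problem summit).
set_option linter.dupNamespace false

open Polynomial IsLocalRing Literature.AlgebraicGeometry.Resolution

namespace Summit.ResolutionOfSingularities.ResolutionOfSingularities.Theorems.SwitchingDichotomy.ThreadChain

/-! ## §3 The eternal isolated radicand chain of a finitely-hit thread (Ĝ) -/

section Assembly

variable {k : Type} {K : Type} [Field k] [Field K] [Algebra k K]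

/-- **Ĝ — an infinite thread without hits is an eternal isolated radicand chain** (G10 `GeoDict.not_noEternalChain_of_dominantTail`
with identity steps). Data: a tower of local blowing ups `R` along centres `P` with strict steps `s i = x·s (i+1) + g` starting at a
finitely generated model (`hR0`), regular members; VISITS `j 0 < j 1 < ⋯` and thread primes `W m` (`m ≥ j 0`) with `W (j k) = P (j k)`,
consecutive contraction `W (m+1) ∩ R m = W m`, all `P (j k)` of height `c`, each visit a permissible centre with the multiplicity
clause (`hmult`) and MINIMAL among singular primes (`hmin`), and NO HIT off the visits (`¬ P m ≤ W m`). Conclusion: the body of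
`NoEternalIsolatedRadicandChain p c` (W4.1 R2 sketch §3.1) FAILS — the germs at the visits `(R (j (k+1)))_{P (j (k+1))}` with the
radicands `s (j k + 1) ^ p` form the forbidden chain (between visits the germ does not move, `locChar_eq_of_le`, and the radicand is
rescaled by units, `isRegularLocalRing_adjoinRoot_rescale`). OURS (W4.1 engine; strat-2 §6″ F-b (i)).
[cite: Cutkosky2014, §2.1] [cite: NovacoskiSpivakovsky2014, Def. 2.11] [cite: Matsumura1987, Thm. 19.3] -/
theorem not_noEternalChain_of_thread (p : ℕ) [hp : Fact p.Prime] [CharP K p]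
    (O : ValuationSubring K) (A₀ : Subalgebra k K) (h₀ : A₀.toSubring ≤ O.toSubring) (hfg : A₀.FG)
    (R : ℕ → Subring K) (P : (i : ℕ) → Ideal (R i)) (s : ℕ → K) (c : ℕ)
    (hR0 : R 0 = locAtCentre A₀.toSubring O)
    (hbl : ∀ i, IsLocalBlowupAlong O (R i) (P i) (R (i + 1)))
    (hst : ∀ i, ∃ x g : K, ((∃ hx : x ∈ R i, (⟨x, hx⟩ : R i) ∈ P i) ∧ x ≠ 0 ∧
      ∀ y : R i, y ∈ P i → O.valuation (y : K) ≤ O.valuation x) ∧ g ∈ R i ∧ s i = x * s (i + 1) + g)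
    (hsp : ∀ i, s i ^ p ∈ R i)
    (hregR : ∀ i, IsRegularLocalRing (R i))
    (j : ℕ → ℕ) (hj : StrictMono j)
    (W : (m : ℕ) → Ideal (R m)) (hWprime : ∀ m, j 0 ≤ m → (W m).IsPrime)
    (hWP : ∀ k, W (j k) = P (j k))
    (hWcomap : ∀ m, j 0 ≤ m → ∃ h : R m ≤ R (m + 1), Ideal.comap (Subring.inclusion h) (W (m + 1)) = W m)
    (hnohit : ∀ m, j 0 ≤ m → (∀ k, m ≠ j k) → ¬ P m ≤ W m)
    (hht : ∀ k, (P (j k)).height = c)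
    (hmult : ∀ k, ∃ g : R (j k), (⟨s (j k) ^ p, hsp (j k)⟩ : R (j k)) - g ^ p ∈ P (j k) ^ p)
    (hmin : ∀ k, ∀ (Q : Ideal (R (j k))) [Q.IsPrime], Q < P (j k) →
      IsRegularLocalRing (AdjoinRoot ((X : (Localization.AtPrime Q)[X]) ^ p -
        C (algebraMap (R (j k)) (Localization.AtPrime Q) ⟨s (j k) ^ p, hsp (j k)⟩)))) :
    ¬ (∀ (L : Type) [Field L] [CharP L p] (S : ℕ → Subring L) [∀ m, IsLocalRing (S m)]
        (hle : ∀ m, S m ≤ S (m + 1)) (f g : ∀ m, S m) (x : ∀ m, S (m + 1)),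
        (∀ m, IsRegularLocalRing (S m)) → (∀ m, IsExcellentRing (S m)) → (∀ m, ringKrullDim (S m) = c) →
        (∀ m, IsQuadraticTransform (S m) (S (m + 1))) →
        (∀ m, Ideal.span ((fun y : S m => (⟨(y : L), hle m y.2⟩ : S (m + 1))) ''
            (maximalIdeal (S m) : Set (S m))) = Ideal.span {x m}) →
        (∀ m, ((f (m + 1) : S (m + 1)) : L) * ((x m : S (m + 1)) : L) ^ p =
            ((f m : S m) : L) - ((g m : S m) : L) ^ p) →
        (∀ m, ∃ h : S m, f m - h ^ p ∈ maximalIdeal (S m) ^ p) →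
        (∀ m, ∀ (Q : Ideal (AdjoinRoot ((X : (S m)[X]) ^ p - C (f m)))) [Q.IsPrime],
            (∃ Q' : Ideal (AdjoinRoot ((X : (S m)[X]) ^ p - C (f m))), Q'.IsPrime ∧ Q < Q') →
            IsRegularLocalRing (Localization.AtPrime Q)) →
        False) := by
  intro hNo
  classical
  -- ### indices
  have hj0 : ∀ k, j 0 ≤ j k := fun k => hj.monotone (Nat.zero_le k)
  have hjlt : ∀ k, j k < j (k + 1) := fun k => hj (Nat.lt_succ_self k)
  have hnotvisit : ∀ k m, j k < m → m < j (k + 1) → ∀ k', m ≠ j k' := by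
    intro k m h1 h2 k' he
    subst he
    have a1 : k < k' := hj.lt_iff_lt.mp h1
    have a2 : k' < k + 1 := hj.lt_iff_lt.mp h2
    omega
  haveI hPprime : ∀ k, (P (j k)).IsPrime := fun k => hWP k ▸ hWprime (j k) (hj0 k)
  -- ### monotonicity of the tower and comap compatibility along intervals
  have hmono : Monotone R := monotone_nat_of_le_succ fun i => (hbl i).isLocalBlowup.le
  choose hRR hWW using hWcomap
  -- `W m' ∩ R m = W m` for `j 0 ≤ m ≤ m'`
  have hWcomap' : ∀ m d, j 0 ≤ m →
      Ideal.comap (Subring.inclusion (hmono (Nat.le_add_right m d))) (W (m + d)) = W m := by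
    intro m d hm
    induction d with
    | zero =>
      ext y
      simp only [Ideal.mem_comap]
      rfl
    | succ d ih =>
      have h1 := hWW (m + d) (by omega)
      rw [← ih, ← h1, Ideal.comap_comap]
      rfl
  -- ### the germs `T m = (R m)_{W m}`
  have hTex : ∀ m, ∃ T : Subring K, j 0 ≤ m → ∀ z : K, z ∈ T ↔ ∃ a b : R m, b ∉ W m ∧ z = (a : K) / b := by
    intro m
    by_cases hm : j 0 ≤ m
    · haveI := hWprime m hm
      obtain ⟨T, hT⟩ := GeoDict.exists_locChar (R m) (W m)
      exact ⟨T, fun _ => hT⟩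
    · exact ⟨⊥, fun h => absurd h hm⟩
  choose T hT using hTex
  -- ### identity steps: `T (m+1) = T m` off the visits
  have hident : ∀ m, j 0 ≤ m → (∀ k, m ≠ j k) → T (m + 1) = T m := by
    intro m hm hnv
    haveI := hWprime m hm
    haveI := hWprime (m + 1) (by omega)
    have hnh := hnohit m hm hnv
    obtain ⟨hRO, u, u₀, hu, hu₀, h0, hval, hR'⟩ := hbl m
    have hu₀P : u₀ ∈ P m := hu ▸ Ideal.subset_span (Finset.mem_coe.mpr hu₀)
    have h0' : ((u₀ : R m) : K) ≠ 0 := fun e => h0 (Subtype.ext e)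
    have hdiv : ∀ y : R m, y ∈ P m → (y : K) / ((u₀ : R m) : K) ∈ R (m + 1) := by
      intro y hy
      rw [hR']
      refine le_locAtCentre _ O ?_
      rw [SteeredMembersRegular.closure_div_eq_of_span_eq (R m) ((u₀ : R m) : K) (↑u : Set (R m)) hu]
      exact SteeredMembersRegular.div_mem_closure_div _ hy
    have hu₀W : u₀ ∉ W m := by
      have := not_mem_of_not_le (hRR m hm) (hWW m hm) (P := P m) (u₀ : R m).2 h0' hdiv hnh
      simpa using this
    exact locChar_eq_of_le (hRR m hm) (hWW m hm) (hT m hm) (hT (m + 1) (by omega)) hR'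
      (closure_le_of_not_mem (hT m hm) hu₀W _)
  -- along a block: `T (j k + 1 + d) = T (j k + 1)` for `j k + 1 + d ≤ j (k+1)`
  have hblockT : ∀ k d, j k + 1 + d ≤ j (k + 1) → T (j k + 1 + d) = T (j k + 1) := by
    intro k d
    induction d with
    | zero => intro; rfl
    | succ d ih =>
      intro hd
      have h1 : T (j k + 1 + d + 1) = T (j k + 1 + d) :=
        hident (j k + 1 + d) (by have := hj0 k; omega)
          (hnotvisit k (j k + 1 + d) (by omega) (by omega))
      rw [show j k + 1 + (d + 1) = j k + 1 + d + 1 by omega, h1, ih (by omega)]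
  have hTvisit : ∀ k, T (j (k + 1)) = T (j k + 1) := by
    intro k
    have := hblockT k (j (k + 1) - (j k + 1)) (by have := hjlt k; omega)
    rwa [show j k + 1 + (j (k + 1) - (j k + 1)) = j (k + 1) by have := hjlt k; omega] at this
  -- ### the chain rings `S k = (R (j (k+1)))_{P (j (k+1))} = T (j k + 1)`
  let S : ℕ → Subring K := fun k => T (j (k + 1))
  have hS : ∀ k, ∀ z : K, z ∈ S k ↔ ∃ a b : R (j (k + 1)), b ∉ P (j (k + 1)) ∧ z = (a : K) / b := by
    intro k z
    have := hT (j (k + 1)) (hj0 _) z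
    rw [hWP] at this
    exact this
  have hS' : ∀ k, ∀ z : K, z ∈ S k ↔ ∃ a b : R (j k + 1), b ∉ W (j k + 1) ∧ z = (a : K) / b := by
    intro k z
    change z ∈ T (j (k + 1)) ↔ _
    rw [hTvisit k]
    exact hT (j k + 1) (by have := hj0 k; omega) z
  haveI hSloc : ∀ k, IsLocalRing (S k) := fun k => GeoDict.isLocalRing_of_locChar (hS k)
  haveI hWp1 : ∀ k, (W (j k + 1)).IsPrime := fun k => hWprime _ (by have := hj0 k; omega)
  have hRS : ∀ k, R (j (k + 1)) ≤ S k := fun k => GeoDict.le_of_locChar (hS k)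
  have hRS' : ∀ k, R (j k + 1) ≤ S k := fun k => GeoDict.le_of_locChar (hS' k)
  -- comap at a visit: `W (j k + 1) ∩ R (j k) = P (j k)`
  have hPcomap : ∀ k, Ideal.comap (Subring.inclusion (hRR (j k) (hj0 k))) (W (j k + 1)) = P (j k) := by
    intro k
    rw [hWW (j k) (hj0 k), hWP]
  -- `S k ≤ S (k+1)`
  have hle : ∀ k, S k ≤ S (k + 1) := fun k =>
    GeoDict.le_of_locChar_of_comap (hRR (j (k + 1)) (hj0 _)) (hPcomap (k + 1)) (hS k) (hS' (k + 1))
  -- ### strict-transform data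
  choose xx gg hxg using hst
  have hxR : ∀ i, xx i ∈ R i := fun i => (hxg i).1.1.1
  have hxP : ∀ i, (⟨xx i, hxR i⟩ : R i) ∈ P i := fun i => (hxg i).1.1.2
  have hx0 : ∀ i, xx i ≠ 0 := fun i => (hxg i).1.2.1
  have hxmax : ∀ i, ∀ y : R i, y ∈ P i → O.valuation (y : K) ≤ O.valuation (xx i) := fun i => (hxg i).1.2.2
  have hgR : ∀ i, gg i ∈ R i := fun i => (hxg i).2.1
  have hsx : ∀ i, s i = xx i * s (i + 1) + gg i := fun i => (hxg i).2.2
  -- off the visits the exceptional parameter avoids the thread prime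
  have hxW : ∀ m, j 0 ≤ m → (∀ k, m ≠ j k) → (⟨xx m, hxR m⟩ : R m) ∉ W m := by
    intro m hm hnv
    haveI := hWprime (m + 1) (by omega)
    have hdiv : ∀ y : R m, y ∈ P m → (y : K) / xx m ∈ R (m + 1) := by
      intro y hy
      obtain ⟨r, hr, hyr⟩ := GeoDict.exists_mem_mul_of_isExcParamAlong (hbl m) ⟨hxR m, hxP m⟩ (hx0 m) (hxmax m) y hy
      rw [hyr, mul_div_cancel_right₀ _ (hx0 m)]
      exact hr
    exact not_mem_of_not_le (hRR m hm) (hWW m hm) (hxR m) (hx0 m) hdiv (hnohit m hm hnv)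
  -- ### block products: `s (j k + 1) = X · s (j k + 1 + d) + G`, `X ∉ W`, along a block
  have hblock : ∀ k d, j k + 1 + d ≤ j (k + 1) → ∃ Xb Gb : K, ∃ hX : Xb ∈ R (j k + 1 + d),
      Gb ∈ R (j k + 1 + d) ∧ (⟨Xb, hX⟩ : R (j k + 1 + d)) ∉ W (j k + 1 + d) ∧
      s (j k + 1) = Xb * s (j k + 1 + d) + Gb := by
    intro k d
    induction d with
    | zero =>
      intro
      haveI := hWp1 k
      refine ⟨1, 0, Subring.one_mem _, Subring.zero_mem _, ?_, by ring⟩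
      exact fun h => (hWp1 k).ne_top ((W (j k + 1)).eq_top_of_isUnit_mem h isUnit_one)
    | succ d ih =>
      intro hd
      obtain ⟨Xb, Gb, hX, hG, hXW, hs⟩ := ih (by omega)
      set m := j k + 1 + d with hmdef
      have hm0 : j 0 ≤ m := by have := hj0 k; omega
      haveI := hWprime m hm0
      haveI := hWprime (m + 1) (by omega)
      have hxWm := hxW m hm0 (hnotvisit k m (by omega) (by omega))
      have hle' : R m ≤ R (m + 1) := hRR m hm0
      refine ⟨Xb * xx m, Xb * gg m + Gb, (R (m + 1)).mul_mem (hle' hX) (hle' (hxR m)),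
        (R (m + 1)).add_mem ((R (m + 1)).mul_mem (hle' hX) (hle' (hgR m))) (hle' hG), ?_, ?_⟩
      · -- `Xb · x_m ∉ W (m+1)` since `W (m+1) ∩ R m = W m` is prime and misses both factors
        intro hmem
        have hmem' : (⟨Xb * xx m, (R (m + 1)).mul_mem (hle' hX) (hle' (hxR m))⟩ : R (m + 1)) ∈ W (m + 1) := hmem
        have hprod : (⟨Xb * xx m, (R (m + 1)).mul_mem (hle' hX) (hle' (hxR m))⟩ : R (m + 1)) =
            Subring.inclusion hle' (⟨Xb, hX⟩ * ⟨xx m, hxR m⟩) := Subtype.ext rfl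
        rw [hprod, ← Ideal.mem_comap, hWW m hm0] at hmem'
        rcases (hWprime m hm0).mem_or_mem hmem' with h | h
        · exact hXW h
        · exact hxWm h
      · rw [show j k + 1 + (d + 1) = m + 1 by omega, hs, hsx m]
        ring
  have hblockv : ∀ k, ∃ Xb Gb : K, ∃ hX : Xb ∈ R (j (k + 1)),
      Gb ∈ R (j (k + 1)) ∧ (⟨Xb, hX⟩ : R (j (k + 1))) ∉ P (j (k + 1)) ∧
      s (j k + 1) = Xb * s (j (k + 1)) + Gb := by
    intro k
    obtain ⟨Xb, Gb, hX, hG, hXW, hs⟩ := hblock k (j (k + 1) - (j k + 1)) (by have := hjlt k; omega)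
    have e : j k + 1 + (j (k + 1) - (j k + 1)) = j (k + 1) := by have := hjlt k; omega
    -- transport along the index equality
    have key : ∀ (n : ℕ) (hn : n = j (k + 1)) (hX : Xb ∈ R n), Gb ∈ R n → (⟨Xb, hX⟩ : R n) ∉ W n →
        s (j k + 1) = Xb * s n + Gb →
        ∃ hX' : Xb ∈ R (j (k + 1)), Gb ∈ R (j (k + 1)) ∧ (⟨Xb, hX'⟩ : R (j (k + 1))) ∉ P (j (k + 1)) ∧
          s (j k + 1) = Xb * s (j (k + 1)) + Gb := by
      intro n hn hX hG hXW hs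
      subst hn
      exact ⟨hX, hG, hWP (k + 1) ▸ hXW, hs⟩
    exact ⟨Xb, Gb, key _ e hX hG hXW hs⟩
  choose Xb Gb hXb hGb hXbP hsb using hblockv
  -- ### chain data
  let f : ∀ k, S k := fun k => ⟨s (j k + 1) ^ p, hRS' k (hsp _)⟩
  let g : ∀ k, S k := fun k => ⟨Xb k * gg (j (k + 1)) + Gb k,
    (S k).add_mem ((S k).mul_mem (hRS k (hXb k)) (hRS k (hgR _))) (hRS k (hGb k))⟩
  let x : ∀ k, S (k + 1) := fun k => ⟨Xb k * xx (j (k + 1)),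
    (S (k + 1)).mul_mem (hle k (hRS k (hXb k))) (hle k (hRS k (hxR _)))⟩
  -- `Xb k` is a unit of `S k`
  have hXunit : ∀ k, IsUnit (⟨Xb k, hRS k (hXb k)⟩ : S k) := by
    intro k
    by_contra hnu
    obtain ⟨a, b, ha, hb, hab⟩ := (GeoDict.not_isUnit_iff_of_locChar (hS k) _).mp hnu
    -- `Xb · b = a ∈ P`, `b ∉ P` ⇒ `Xb ∈ P`
    have hb0 := GeoDict.coe_ne_zero_of_not_mem hb
    have heq : (⟨Xb k, hXb k⟩ : R (j (k + 1))) * b = a := by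
      apply Subtype.ext
      change Xb k * (b : K) = a
      change (Xb k : K) = a / b at hab
      rw [hab, div_mul_cancel₀ _ hb0]
    have : (⟨Xb k, hXb k⟩ : R (j (k + 1))) * b ∈ P (j (k + 1)) := heq ▸ ha
    rcases (hPprime (k + 1)).mem_or_mem this with h | h
    · exact hXbP k h
    · exact hb h
  -- ### the eight obligations of the chain
  refine @hNo K _ _ S hSloc hle f g x (fun m => ?_) (fun m => ?_) (fun m => ?_) (fun m => ?_) (fun m => ?_)
    (fun m => ?_) (fun m => ?_) (fun m => ?_)
  · -- regularity (Serre)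
    haveI := hregR (j (m + 1))
    exact GeoDict.isRegularLocalRing_of_locChar (hS m)
  · -- excellence (model + Stacks 07QW/07QU)
    obtain ⟨A₁, -, -, hfg₁, hRA₁⟩ := SteeredExit.exists_model_of_tower O A₀ h₀ hfg hR0 (N := j (m + 1))
      fun i _ => (hbl i).isLocalBlowup
    exact GeoDict.isExcellentRing_of_locChar O A₁ hfg₁ hRA₁ (hS m)
  · -- dimension = height = c
    rw [GeoDict.ringKrullDim_of_locChar (hS m), hht]
    rfl
  · -- quadratic transform at the visit `j (m+1)`
    exact GeoDict.isQuadraticTransform_of_isLocalBlowupAlong (hbl (j (m + 1))) (hRR (j (m + 1)) (hj0 _))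
      (hPcomap (m + 1)) (hS m) (hS' (m + 1))
  · -- the exceptional parameter (times the unit `Xb m`) generates `𝔪_{S m}·S (m+1)`
    have hdiv := GeoDict.exists_mem_mul_of_isExcParamAlong (hbl (j (m + 1))) ⟨hxR _, hxP _⟩ (hx0 _) (hxmax _)
    have h1 := GeoDict.span_image_maximalIdeal_eq_of_locChar (hRR (j (m + 1)) (hj0 _)) (hPcomap (m + 1)) (hS m)
      (hS' (m + 1)) (hle m) ⟨xx (j (m + 1)), hxR _⟩ (hxP _) hdiv (hle m (hRS m (hxR _)))
    rw [h1]
    have hu : IsUnit (⟨Xb m, hle m (hRS m (hXb m))⟩ : S (m + 1)) := (hXunit m).map (Subring.inclusion (hle m))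
    have hxm : x m = ⟨Xb m, hle m (hRS m (hXb m))⟩ * ⟨xx (j (m + 1)), hle m (hRS m (hxR _))⟩ := Subtype.ext rfl
    rw [hxm, Ideal.span_singleton_mul_left_unit hu]
  · -- the Frobenius relation from `s (j m + 1) = Xb·s (j (m+1)) + Gb`, `s (j (m+1)) = x·s' + g`
    show (s (j (m + 1) + 1) ^ p) * (Xb m * xx (j (m + 1))) ^ p =
      s (j m + 1) ^ p - (Xb m * gg (j (m + 1)) + Gb m) ^ p
    have h := hsb m
    have h' := hsx (j (m + 1))
    have : s (j m + 1) - (Xb m * gg (j (m + 1)) + Gb m) = (Xb m * xx (j (m + 1))) * s (j (m + 1) + 1) := by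
      rw [h, h']; ring
    rw [← sub_pow_char, this]
    ring
  · -- cleaned multiplicity from the permissible centre at the visit, rescaled
    obtain ⟨g₀, hg₀⟩ := hmult (m + 1)
    have hmem := GeoDict.mem_maximalIdeal_pow_of_locChar (hS m) hg₀
    refine ⟨⟨Xb m * (g₀ : K) + Gb m,
      (S m).add_mem ((S m).mul_mem (hRS m (hXb m)) (hRS m g₀.2)) (hRS m (hGb m))⟩, ?_⟩
    have heq : f m - ⟨Xb m * (g₀ : K) + Gb m,
        (S m).add_mem ((S m).mul_mem (hRS m (hXb m)) (hRS m g₀.2)) (hRS m (hGb m))⟩ ^ p =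
        (⟨Xb m, hRS m (hXb m)⟩ : S m) ^ p *
          ⟨(((⟨s (j (m + 1)) ^ p, hsp _⟩ : R (j (m + 1))) - g₀ ^ p : R (j (m + 1))) : K),
            GeoDict.le_of_locChar (hS m) ((⟨s (j (m + 1)) ^ p, hsp _⟩ : R (j (m + 1))) - g₀ ^ p).2⟩ := by
      apply Subtype.ext
      change s (j m + 1) ^ p - (Xb m * (g₀ : K) + Gb m) ^ p = Xb m ^ p * (s (j (m + 1)) ^ p - (g₀ : K) ^ p)
      rw [hsb m, add_pow_char, add_pow_char, mul_pow, mul_pow]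
      ring
    rw [heq]
    exact Ideal.mul_mem_left _ _ hmem
  · -- isolatedness from minimality at the visit (res-type-096 p502861), after the unit rescaling
    intro Q hQp hQ
    haveI : Q.IsPrime := hQp
    haveI := hregR (j (m + 1))
    letI : Algebra (R (j (m + 1))) (S m) := (Subring.inclusion (hRS m)).toAlgebra
    haveI : IsLocalization.AtPrime (S m) (P (j (m + 1))) := GeoDict.isLocalization_of_locChar (hS m) fun r => rfl
    have hjm : j m + 1 ≤ j (m + 1) := hjlt m
    have hfR : s (j m + 1) ^ p ∈ R (j (m + 1)) := hmono hjm (hsp _)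
    -- the rescaled radicand identity in `K`
    have hK : s (j m + 1) ^ p = Xb m ^ p * s (j (m + 1)) ^ p + Gb m ^ p := by
      rw [hsb m, add_pow_char, mul_pow]
    have hmin' : ∀ (Q' : Ideal (R (j (m + 1)))) [Q'.IsPrime], Q' < P (j (m + 1)) →
        IsRegularLocalRing (AdjoinRoot ((X : (Localization.AtPrime Q')[X]) ^ p -
          C (algebraMap (R (j (m + 1))) (Localization.AtPrime Q') ⟨s (j m + 1) ^ p, hfR⟩))) := by
      intro Q' _ hQ'
      haveI : CharP (Localization.AtPrime Q') p := AutoPermissible.charP_localization_atPrime (S := R (j (m + 1))) p Q'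
      have hXQ' : (⟨Xb m, hXb m⟩ : R (j (m + 1))) ∉ Q' := fun h => hXbP m (hQ'.le h)
      have hu : IsUnit (algebraMap (R (j (m + 1))) (Localization.AtPrime Q') ⟨Xb m, hXb m⟩) :=
        IsLocalization.map_units (Localization.AtPrime Q') (⟨⟨Xb m, hXb m⟩, hXQ'⟩ : Q'.primeCompl)
      have hReq : (⟨s (j m + 1) ^ p, hfR⟩ : R (j (m + 1))) =
          ⟨Xb m, hXb m⟩ ^ p * ⟨s (j (m + 1)) ^ p, hsp _⟩ + ⟨Gb m, hGb m⟩ ^ p := by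
        apply Subtype.ext
        simp only [Subring.coe_add, Subring.coe_mul, Subring.coe_pow]
        exact hK
      have hfeq : algebraMap (R (j (m + 1))) (Localization.AtPrime Q') ⟨s (j m + 1) ^ p, hfR⟩ =
          (algebraMap (R (j (m + 1))) (Localization.AtPrime Q') ⟨Xb m, hXb m⟩) ^ p *
              algebraMap (R (j (m + 1))) (Localization.AtPrime Q') ⟨s (j (m + 1)) ^ p, hsp _⟩ +
            (algebraMap (R (j (m + 1))) (Localization.AtPrime Q') ⟨Gb m, hGb m⟩) ^ p := by
        rw [hReq, map_add, map_mul, map_pow, map_pow]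
      exact isRegularLocalRing_adjoinRoot_rescale p hu hfeq (hmin (m + 1) Q' hQ')
    exact @GeoDict.isRegularLocalRing_localization_atPrime_adjoinRoot_of_forall_lt (R (j (m + 1))) _ p _
      (⟨s (j m + 1) ^ p, hfR⟩ : R (j (m + 1))) (P (j (m + 1))) _ (S m) _ _ _ _
      (fun Q' hQ'p hQ' => by haveI := hQ'p; exact hmin' Q' hQ') Q hQp hQ

end Assembly

end Summit.ResolutionOfSingularities.ResolutionOfSingularities.Theorems.SwitchingDichotomy.ThreadChain

end
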